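import Summits.Ventures.PercRepro.S1CoreCapFreeSeq
import Mathlib.Combinatorics.Enumerative.DoubleCounting

/-!
# PercRepro — TOWARDS `Q*(5) = 11`: FAMILIES OF 3-POINT LINES UNDER A FREE-LINE BUDGET (p1, gen 24)

The abstract counting behind the cases `n₄ ≤ 1` of `Q*(5) = 11`. A family `T` of 3-point lines (pairwise `≤ 1`
common point, each meeting a pre-covered set `P₀` in `≤ 1` point, weights `1` or `2`, weight `≤ 4`) with a BUDGET
`b`: every list of lines of `T` has `freeCountR P₀ l + fat (unionLR P₀ l) ≤ b` (`S1CoreCapFreeSeq`'s master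
inequality). Then: `2 · #T ≤ b (b + 1)` (`card_le_of_budget`); through a fat point `p ∉ P₀` pass `≤ b − 1` lines
(`deg_fat_le`), `≤ b − 3` if a second fat point exists (`deg_fat_le_of_two`: its line is free and adds a fat point),
and three fat points cost `3 + 3` (`not_three_fat`); the lines avoiding a fat point have budget `b − 2`
(`budget_not_through`). The cap sum of `T` is `#T + Σ_L fat L`, and `Σ_L fat L = Σ_{p fat} deg p` by double
counting (`sum_fat_eq_sum_deg`). `proofs/P1-S4-CAPBRIDGE.md` §16. Axioms: standard.
-/

namespace PercRepro

namespace S1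

namespace FourCap

variable {β : Type} [DecidableEq β]

omit [DecidableEq β] in
/-- A 3-point line of weight `≤ 4` has no two fat points. -/
theorem two_fat_false {w : β → ℕ} {L : Finset β} (hw : ∀ v ∈ L, w v = 1 ∨ w v = 2) (hw4 : wsum w L ≤ 4)
    (hk : 3 ≤ L.card) {p q : β} (hp : p ∈ L) (hq : q ∈ L) (hpq : p ≠ q) (hp2 : w p = 2) (hq2 : w q = 2) :
    False := by
  have := wsum_eq_card_add_fat w L hw
  have : 1 < fat w L := by
    unfold fat
    exact Finset.one_lt_card.2 ⟨p, Finset.mem_filter.2 ⟨hp, hp2⟩, q, Finset.mem_filter.2 ⟨hq, hq2⟩, hpq⟩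
  omega

omit [DecidableEq β] in
/-- A fat point of a set makes `fat ≥ 1`. -/
theorem one_le_fat {w : β → ℕ} {S : Finset β} {p : β} (hp : p ∈ S) (hp2 : w p = 2) : 1 ≤ fat w S := by
  unfold fat
  exact Finset.card_pos.2 ⟨p, Finset.mem_filter.2 ⟨hp, hp2⟩⟩

omit [DecidableEq β] in
/-- Two distinct fat points of a set make `fat ≥ 2`. -/
theorem two_le_fat {w : β → ℕ} {S : Finset β} {p q : β} (hp : p ∈ S) (hq : q ∈ S) (hpq : p ≠ q) (hp2 : w p = 2)
    (hq2 : w q = 2) : 2 ≤ fat w S := by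
  unfold fat
  exact Finset.one_lt_card.2 ⟨p, Finset.mem_filter.2 ⟨hp, hp2⟩, q, Finset.mem_filter.2 ⟨hq, hq2⟩, hpq⟩

omit [DecidableEq β] in
/-- Three distinct fat points of a set make `fat ≥ 3`. -/
theorem three_le_fat {w : β → ℕ} {S : Finset β} {p q r : β} (hp : p ∈ S) (hq : q ∈ S) (hr : r ∈ S) (hpq : p ≠ q)
    (hpr : p ≠ r) (hqr : q ≠ r) (hp2 : w p = 2) (hq2 : w q = 2) (hr2 : w r = 2) : 3 ≤ fat w S := by
  unfold fat
  exact Finset.two_lt_card.2 ⟨p, Finset.mem_filter.2 ⟨hp, hp2⟩, q, Finset.mem_filter.2 ⟨hq, hq2⟩, r,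
    Finset.mem_filter.2 ⟨hr, hr2⟩, hpq, hpr, hqr⟩

section Thin

variable {w : β → ℕ} {P₀ : Finset β} {T : Finset (Finset β)} {b : ℕ}
  (hT3 : ∀ L ∈ T, L.card = 3 ∧ (L ∩ P₀).card ≤ 1)
  (hTpair : ∀ L ∈ T, ∀ L' ∈ T, L ≠ L' → (L ∩ L').card ≤ 1)
  (hTw : ∀ L ∈ T, ∀ v ∈ L, w v = 1 ∨ w v = 2)
  (hTw4 : ∀ L ∈ T, wsum w L ≤ 4)
  (hB : ∀ l : List (Finset β), l.Nodup → (∀ L ∈ l, L ∈ T) → freeCountR P₀ l + fat w (unionLR P₀ l) ≤ b)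

include hT3 hTpair hB in
/-- **The size of a family under budget `b`**: `2 · #T ≤ b (b + 1)` (the counting lemma, the fat points dropped). -/
theorem card_le_of_budget : 2 * T.card ≤ b * (b + 1) :=
  two_mul_card_le_of_freeCountR P₀ b T hT3 hTpair (fun l hnd hl => by have := hB l hnd hl; omega)

include hT3 hTpair hB in
/-- **Through a fat point pass at most `b − 1` lines**: they form a free sequence and bring the fat point. -/
theorem deg_fat_le {p : β} (hpP : p ∉ P₀) (hp2 : w p = 2) {A : Finset β} (hA : A ∈ T) (hpA : p ∈ A) :
    (T.filter (fun L => p ∈ L)).card + 1 ≤ b := by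
  set l := (T.filter (fun L => p ∈ L)).toList with hl
  have hmem : ∀ L ∈ l, L ∈ T ∧ p ∈ L := fun L hL => Finset.mem_filter.1 (Finset.mem_toList.1 hL)
  have hfree := freeCountR_eq_length_of_mem P₀ hpP l (Finset.nodup_toList _)
    (fun L hL => ⟨(hT3 L (hmem L hL).1).1, (hmem L hL).2, (hT3 L (hmem L hL).1).2⟩)
    (fun L hL L' hL' hne => hTpair L (hmem L hL).1 L' (hmem L' hL').1 hne)
  have hAl : A ∈ l := Finset.mem_toList.2 (Finset.mem_filter.2 ⟨hA, hpA⟩)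
  have hfat : 1 ≤ fat w (unionLR P₀ l) := one_le_fat (mem_unionLR_of_mem hAl hpA) hp2
  have h := hB l (Finset.nodup_toList _) (fun L hL => (hmem L hL).1)
  rw [hfree, Finset.length_toList] at h
  omega

include hT3 hTpair hTw hTw4 hB in
/-- **With a second fat point, through a fat point pass at most `b − 3` lines**: a line through the second fat
point is free after the lines through the first (the second point is new) and the union carries two fat points. -/
theorem deg_fat_le_of_two {p q : β} (hpP : p ∉ P₀) (hqP : q ∉ P₀) (hp2 : w p = 2) (hq2 : w q = 2) (hpq : p ≠ q)
    {A B : Finset β} (hA : A ∈ T) (hpA : p ∈ A) (hB' : B ∈ T) (hqB : q ∈ B) :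
    (T.filter (fun L => p ∈ L)).card + 3 ≤ b := by
  set l := (T.filter (fun L => p ∈ L)).toList with hl
  have hmem : ∀ L ∈ l, L ∈ T ∧ p ∈ L := fun L hL => Finset.mem_filter.1 (Finset.mem_toList.1 hL)
  have hfree := freeCountR_eq_length_of_mem P₀ hpP l (Finset.nodup_toList _)
    (fun L hL => ⟨(hT3 L (hmem L hL).1).1, (hmem L hL).2, (hT3 L (hmem L hL).1).2⟩)
    (fun L hL L' hL' hne => hTpair L (hmem L hL).1 L' (hmem L' hL').1 hne)
  have hAl : A ∈ l := Finset.mem_toList.2 (Finset.mem_filter.2 ⟨hA, hpA⟩)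
  -- `q` lies on no line through `p`
  have hql : ∀ L ∈ l, q ∉ L := fun L hL hqL =>
    two_fat_false (hTw L (hmem L hL).1) (hTw4 L (hmem L hL).1) (by rw [(hT3 L (hmem L hL).1).1]) (hmem L hL).2
      hqL hpq hp2 hq2
  have hBl : B ∉ l := fun h => hql B h hqB
  have hnd : (B :: l).Nodup := List.nodup_cons.2 ⟨hBl, Finset.nodup_toList _⟩
  have h := hB (B :: l) hnd (fun L hL => by
    rcases List.mem_cons.1 hL with rfl | hL
    · exact hB'
    · exact (hmem L hL).1)
  rw [freeCountR_cons_of_new hqB hqP hql, hfree, Finset.length_toList] at h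
  have hfat : 2 ≤ fat w (unionLR P₀ (B :: l)) :=
    two_le_fat (mem_unionLR_of_mem (List.mem_cons_of_mem _ hAl) hpA) (mem_unionLR_of_mem List.mem_cons_self hqB)
      hpq hp2 hq2
  omega

include hT3 hTw hTw4 hB in
/-- **Three fat points cost `3 + 3`**: their three lines are all free and the union carries three fat points. -/
theorem not_three_fat {p q r : β} (hpP : p ∉ P₀) (hqP : q ∉ P₀) (hrP : r ∉ P₀) (hp2 : w p = 2) (hq2 : w q = 2)
    (hr2 : w r = 2) (hpq : p ≠ q) (hpr : p ≠ r) (hqr : q ≠ r) {A B C : Finset β} (hA : A ∈ T) (hpA : p ∈ A)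
    (hB' : B ∈ T) (hqB : q ∈ B) (hC : C ∈ T) (hrC : r ∈ C) : 6 ≤ b := by
  have k3 : ∀ L ∈ T, 3 ≤ L.card := fun L hL => by rw [(hT3 L hL).1]
  have hqA : q ∉ A := fun h => two_fat_false (hTw A hA) (hTw4 A hA) (k3 A hA) hpA h hpq hp2 hq2
  have hrA : r ∉ A := fun h => two_fat_false (hTw A hA) (hTw4 A hA) (k3 A hA) hpA h hpr hp2 hr2
  have hrB : r ∉ B := fun h => two_fat_false (hTw B hB') (hTw4 B hB') (k3 B hB') hqB h hqr hq2 hr2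
  have hBA : B ≠ A := fun h => hqA (h ▸ hqB)
  have hCA : C ≠ A := fun h => hrA (h ▸ hrC)
  have hCB : C ≠ B := fun h => hrB (h ▸ hrC)
  have hnd : [C, B, A].Nodup := by simp [hBA, hCA, hCB]
  have h := hB [C, B, A] hnd (by simp [hA, hB', hC])
  have f1 : freeCountR P₀ [A] = freeCountR P₀ [] + 1 := freeCountR_cons_of_new hpA hpP (by simp)
  have f2 : freeCountR P₀ [B, A] = freeCountR P₀ [A] + 1 := freeCountR_cons_of_new hqB hqP (by simpa using hqA)
  have f3 : freeCountR P₀ [C, B, A] = freeCountR P₀ [B, A] + 1 :=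
    freeCountR_cons_of_new hrC hrP (by simp [hrA, hrB])
  have hfat : 3 ≤ fat w (unionLR P₀ [C, B, A]) :=
    three_le_fat (mem_unionLR_of_mem (by simp) hpA) (mem_unionLR_of_mem (by simp) hqB)
      (mem_unionLR_of_mem (by simp) hrC) hpq hpr hqr hp2 hq2 hr2
  have f0 : freeCountR P₀ ([] : List (Finset β)) = 0 := rfl
  omega

include hB in
/-- **The lines avoiding a fat point have budget `b − 2`**: prepend a line through the fat point (free, since the
point is new) and count the fat point. -/
theorem budget_not_through {p : β} (hpP : p ∉ P₀) (hp2 : w p = 2) {A : Finset β} (hA : A ∈ T) (hpA : p ∈ A) :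
    ∀ l : List (Finset β), l.Nodup → (∀ L ∈ l, L ∈ T.filter (fun L => p ∉ L)) → freeCountR P₀ l + 2 ≤ b := by
  intro l hnd hl
  have hpl : ∀ L ∈ l, p ∉ L := fun L hL => (Finset.mem_filter.1 (hl L hL)).2
  have hAl : A ∉ l := fun h => hpl A h hpA
  have h := hB (A :: l) (List.nodup_cons.2 ⟨hAl, hnd⟩) (fun L hL => by
    rcases List.mem_cons.1 hL with rfl | hL
    · exact hA
    · exact (Finset.mem_filter.1 (hl L hL)).1)
  rw [freeCountR_cons_of_new hpA hpP hpl] at h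
  have hfat : 1 ≤ fat w (unionLR P₀ (A :: l)) := one_le_fat (mem_unionLR_of_mem List.mem_cons_self hpA) hp2
  omega

end Thin

/-- The fat points on the lines of a family. -/
def fatPoints (w : β → ℕ) (T : Finset (Finset β)) : Finset β := (T.biUnion id).filter (fun v => w v = 2)

/-- Membership in the fat points of a family. -/
theorem mem_fatPoints {w : β → ℕ} {T : Finset (Finset β)} {v : β} :
    v ∈ fatPoints w T ↔ (∃ L ∈ T, v ∈ L) ∧ w v = 2 := by
  unfold fatPoints
  simp only [Finset.mem_filter, Finset.mem_biUnion, id]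

/-- **Double counting the fat points**: `Σ_{L ∈ T} fat L = Σ_{p ∈ fatPoints} #{L ∈ T | p ∈ L}`. -/
theorem sum_fat_eq_sum_deg (w : β → ℕ) (T : Finset (Finset β)) :
    ∑ L ∈ T, fat w L = ∑ p ∈ fatPoints w T, (T.filter (fun L => p ∈ L)).card := by
  have h := Finset.sum_card_bipartiteAbove_eq_sum_card_bipartiteBelow
    (r := fun (L : Finset β) (u : β) => u ∈ L) (s := T) (t := fatPoints w T)
  have hl : ∀ L ∈ T, fat w L = ((fatPoints w T).bipartiteAbove (fun (L : Finset β) (u : β) => u ∈ L) L).card := by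
    intro L hL
    unfold fat Finset.bipartiteAbove
    congr 1
    ext v
    simp only [Finset.mem_filter, mem_fatPoints]
    constructor
    · rintro ⟨hv, hv2⟩
      exact ⟨⟨⟨L, hL, hv⟩, hv2⟩, hv⟩
    · rintro ⟨⟨_, hv2⟩, hv⟩
      exact ⟨hv, hv2⟩
  rw [Finset.sum_congr rfl hl, h]
  rfl

/-- The cap of a 3-point line with at most one fat point is `1 + fat`. -/
theorem capPaper_three_eq {f : ℕ} (hf : f ≤ 1) : capPaper 3 f = 1 + f := by
  rcases (by omega : f = 0 ∨ f = 1) with rfl | rfl <;> decide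

omit [DecidableEq β] in
/-- **The cap sum of a family of 3-point lines** (weights `≤ 4`) is `#T + Σ_L fat L`. -/
theorem sum_cap_eq_card_add_sum_fat {w : β → ℕ} {T : Finset (Finset β)}
    (hT3 : ∀ L ∈ T, L.card = 3) (hTw : ∀ L ∈ T, ∀ v ∈ L, w v = 1 ∨ w v = 2) (hTw4 : ∀ L ∈ T, wsum w L ≤ 4) :
    ∑ L ∈ T, capPaper L.card (fat w L) = T.card + ∑ L ∈ T, fat w L := by
  have hcap : ∀ L ∈ T, capPaper L.card (fat w L) = 1 + fat w L := by
    intro L hL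
    have := wsum_eq_card_add_fat w L (hTw L hL)
    have := hTw4 L hL
    have := hT3 L hL
    rw [hT3 L hL]
    exact capPaper_three_eq (by omega)
  rw [Finset.sum_congr rfl hcap, Finset.sum_add_distrib, ← Finset.card_eq_sum_ones]

end FourCap

end S1

end PercRepro
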